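import Mathlib
import Literature.Barriers.ValiantsHypothesis.AlgebraicNaturalProofs
import Literature.Computability.AlgebraicComplexity.RazUniversalCircuits
import Literature.Computability.AlgebraicComplexity.ValiantClasses
import Literature.Computability.AlgebraicComplexity.ArithCircuitProofs
import Literature.Computability.AlgebraicComplexity.HamiltonianCycleVNP
import Literature.Barriers.ValiantsHypothesis.ShiftedPartialsTwoPowers
import Summits.ValiantsHypothesis.ValiantsHypothesis.Theorems.BarrierLeverDefinableEquationsDefs

/-!
# Crux `BarrierLever.DefinableEquations` (stmt-ValiantsHypothesis-8745), line `registered`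
# (raz-tableau) — registered stub `stub_selGadget` (V3): the SELECTOR GADGET

**Claim settled** (`selSpec n τ B` for every `B`-bounded datum `τ`, `n ≥ 1`): for every block
`k < τ.D` there is a polynomial `G k` in the top coefficient variables `X_e`
(`e ∈ topMonomials n`, `Sum.inl`) and the one-hot Boolean block `BPos τ.D n`
(`Sum.inr ((k, pos), l)` is "the index at position `pos` of block `k` equals `l`") such that at
the one-hot point of every index function `i` the value of `G k` is the single variable
`X_{expOf (i (k, ·))}`, of size `≤ (B + n + 2)^4 · C(2n, n)` and degree `≤ (B + n + 2)^3`.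

**Witness** (Lagrange count-indicators; no definitions, the witness is written out).  For block
`k` and value `l` the block sum `T_{k,l} := Σ_pos Z_{(k,pos),l}` evaluates at the one-hot point of
`i` to the COUNT `#{pos | i (k,pos) = l} = (expOf (i (k,·))) l ≤ n` (`aeval_blockSum`).  The
Lagrange indicator `Λ_{n,c}(T) := ∏_{w ≤ n, w ≠ c} (c - w)⁻¹ (T - w)` satisfies
`Λ_{n,c}(t) = [t = c]` for naturals `t ≤ n` (`lagrange_scalar`, `aeval_lagrange`), hence
`G k := Σ_{e ∈ topMonomials n} (∏_l Λ_{n, e l}(T_{k,l})) · X_e` evaluates to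
`Σ_e [expOf (i (k,·)) = e] X_e = X_{expOf (i (k,·))}` (`aeval_gadget`).  Size:
`#topMonomials n = C(2n-1, n) ≤ C(2n, n)` summands (`card_topMonomials_le`), each of size
`≤ n((n+1)(n+2) + (n+1)) + n + 1`, in total `≤ C(2n,n) · (n+2)^4` (`complexity_gadget_le`);
degree `≤ n (n+1) + 1 ≤ (n+2)^3` (`totalDegree_gadget_le`).

Unconditional (axioms `propext`, `Classical.choice`, `Quot.sound`).  References: P. Bürgisser,
*Completeness and Reduction in Algebraic Complexity Theory* (2000), §2.1 (size calculus),
Prop. 2.20 (Valiant's criterion); Lagrange interpolation is folklore.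
-/

-- layout Summits/ValiantsHypothesis/ValiantsHypothesis forces the duplicated namespace component
set_option linter.dupNamespace false

noncomputable section

namespace Summit.ValiantsHypothesis.ValiantsHypothesis.Theorems.BarrierLeverDefinableEquations

open MvPolynomial Literature.Computability.AlgebraicComplexity
open Literature.Barriers.ValiantsHypothesis

namespace SelGadget

/-! ### The Lagrange count-indicator `Λ_{n,c}(T) = ∏_{w ≤ n, w ≠ c} (c - w)⁻¹ · (T + (-w))` -/

/-- Scalar Lagrange indicator on `{0, …, n}`: `∏_{w ≤ n, w ≠ c} (c - w)⁻¹ (t - w) = [t = c]` for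
every natural `t ≤ n` (if `t = c` every factor is `1`; otherwise the factor `w = t` vanishes).
[folklore] -/
theorem lagrange_scalar (n c t : ℕ) (ht : t ≤ n) :
    (∏ w ∈ (Finset.range (n + 1)).erase c, (((c : ℂ) - w)⁻¹ * ((t : ℂ) + -(w : ℂ)))) =
      if t = c then 1 else 0 := by
  split_ifs with h
  · subst h
    refine Finset.prod_eq_one fun w hw => ?_
    have hne : (t : ℂ) - w ≠ 0 := by
      rw [sub_ne_zero]
      exact_mod_cast (Finset.ne_of_mem_erase hw).symm
    rw [← sub_eq_add_neg, inv_mul_cancel₀ hne]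
  · refine Finset.prod_eq_zero (i := t) ?_ ?_
    · exact Finset.mem_erase.2 ⟨h, Finset.mem_range.2 (Nat.lt_succ_of_le ht)⟩
    · rw [← sub_eq_add_neg, sub_self, mul_zero]

variable {σ : Type*}

/-- The polynomial Lagrange indicator `Λ_{n,c}(T)` evaluates, under any `ℂ`-algebra map sending
`T` to a natural number `t ≤ n`, to `[t = c]`. [folklore] -/
theorem aeval_lagrange {S : Type*} [CommRing S] [Algebra ℂ S] (φ : MvPolynomial σ ℂ →ₐ[ℂ] S)
    (T : MvPolynomial σ ℂ) {n c t : ℕ} (ht : t ≤ n) (hT : φ T = (t : S)) :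
    φ (∏ w ∈ (Finset.range (n + 1)).erase c,
        (C (((c : ℂ) - (w : ℂ))⁻¹) * (T + C (-(w : ℂ))))) = if t = c then 1 else 0 := by
  have h1 : (t : S) = algebraMap ℂ S (t : ℂ) := (map_natCast _ t).symm
  have hC : ∀ r : ℂ, φ (C r) = algebraMap ℂ S r := fun r => by
    rw [← MvPolynomial.algebraMap_eq]
    exact φ.commutes r
  have h2 : ∀ w ∈ (Finset.range (n + 1)).erase c,
      φ (C (((c : ℂ) - (w : ℂ))⁻¹) * (T + C (-(w : ℂ)))) =
        algebraMap ℂ S (((c : ℂ) - w)⁻¹ * ((t : ℂ) + -(w : ℂ))) := by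
    intro w _
    rw [map_mul, map_add, hC, hC, hT, h1, ← map_add, ← map_mul]
  rw [map_prod, Finset.prod_congr rfl h2, ← map_prod, lagrange_scalar n c t ht]
  split_ifs <;> simp

/-- Size of the Lagrange indicator: `≤ (n+1)(n+2) + (n+1)` when `L(T) ≤ n` (at most `n + 1`
factors, each of size `≤ n + 2`; Bürgisser 2000, §2.1). [folklore] -/
theorem complexity_lagrange_le (T : MvPolynomial σ ℂ) {n : ℕ} (c : ℕ) (hT : complexity T ≤ n) :
    complexity (∏ w ∈ (Finset.range (n + 1)).erase c,
        (C (((c : ℂ) - (w : ℂ))⁻¹) * (T + C (-(w : ℂ))))) ≤ (n + 1) * (n + 2) + (n + 1) := by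
  have hcard : ((Finset.range (n + 1)).erase c).card ≤ n + 1 :=
    (Finset.card_erase_le).trans (Finset.card_range _).le
  have hf : ∀ w ∈ (Finset.range (n + 1)).erase c,
      complexity (C (((c : ℂ) - (w : ℂ))⁻¹) * (T + C (-(w : ℂ))) : MvPolynomial σ ℂ) ≤ n + 2 := by
    intro w _
    have h1 := complexity_mul_le_holds (C (((c : ℂ) - (w : ℂ))⁻¹) : MvPolynomial σ ℂ)
      (T + C (-(w : ℂ)))
    have h2 := complexity_add_le_holds T (C (-(w : ℂ)) : MvPolynomial σ ℂ)
    have h3 := complexity_C_holds (σ := σ) (((c : ℂ) - (w : ℂ))⁻¹)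
    have h4 := complexity_C_holds (σ := σ) (-(w : ℂ))
    omega
  exact (complexity_prod_le_of_le _ _ _ hf).trans
    (Nat.add_le_add (Nat.mul_le_mul_right _ hcard) hcard)

/-- Degree of the Lagrange indicator: `≤ n + 1` when `deg T ≤ 1`. [folklore] -/
theorem totalDegree_lagrange_le (T : MvPolynomial σ ℂ) {n : ℕ} (c : ℕ) (hT : T.totalDegree ≤ 1) :
    (∏ w ∈ (Finset.range (n + 1)).erase c,
        (C (((c : ℂ) - (w : ℂ))⁻¹) * (T + C (-(w : ℂ))))).totalDegree ≤ n + 1 := by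
  have hcard : ((Finset.range (n + 1)).erase c).card ≤ n + 1 :=
    (Finset.card_erase_le).trans (Finset.card_range _).le
  have hf : ∀ w ∈ (Finset.range (n + 1)).erase c,
      (C (((c : ℂ) - (w : ℂ))⁻¹) * (T + C (-(w : ℂ))) : MvPolynomial σ ℂ).totalDegree ≤ 1 := by
    intro w _
    refine (totalDegree_mul _ _).trans ?_
    rw [totalDegree_C, zero_add]
    refine (totalDegree_add _ _).trans (max_le hT ?_)
    rw [totalDegree_C]
    exact Nat.zero_le _
  refine (totalDegree_prod_le_of_le _ _ 1 hf).trans ?_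
  rw [mul_one]
  exact hcard

/-! ### Counting and arithmetic -/

variable {n : ℕ}

/-- The exponent vector counts positions: `(expOf v) l = #{pos | v pos = l}`. [folklore] -/
theorem expOf_apply (v : Fin n → Fin n) (l : Fin n) :
    expOf v l = (Finset.univ.filter fun pos => v pos = l).card := by
  simp [expOf, Finsupp.finsetSum_apply, Finsupp.single_apply, Finset.sum_boole]

/-- Each coordinate of `expOf v` is at most its degree `n`. [folklore] -/
theorem expOf_apply_le (v : Fin n → Fin n) (l : Fin n) : expOf v l ≤ n :=
  (Finsupp.le_degree l (expOf v)).trans (degree_expOf v).le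

/-- `#topMonomials n = C(2n - 1, n) ≤ C(2n, n)` (for any `Fintype` structure). [folklore] -/
theorem card_topMonomials_le (n : ℕ) [Fintype (topMonomials n)] :
    Fintype.card (topMonomials n) ≤ (2 * n).choose n := by
  classical
  rw [Fintype.card_of_finset' (p := topMonomials n)
      ((Finset.univ : Finset (Fin n)).finsuppAntidiag n)
      (fun e => (degree_eq_iff_mem_finsuppAntidiag e n).symm),
    card_finsuppAntidiag_univ, Fintype.card_fin]
  exact Nat.choose_le_choose n (by omega)

/-- Size arithmetic: `n((n+1)(n+2) + (n+1)) + n + 2 ≤ (B + n + 2)^4`. [folklore] -/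
theorem arith_size (B n : ℕ) :
    n * ((n + 1) * (n + 2) + (n + 1)) + n + 1 + 1 ≤ (B + n + 2) ^ 4 := by
  have h1 : n * ((n + 1) * (n + 2) + (n + 1)) + n + 1 + 1 ≤ (n + 2) ^ 4 :=
    calc n * ((n + 1) * (n + 2) + (n + 1)) + n + 1 + 1
        ≤ n * ((n + 1) * (n + 2) + (n + 1)) + n + 1 + 1 +
          (n ^ 4 + 7 * n ^ 3 + 20 * n ^ 2 + 28 * n + 14) := Nat.le_add_right _ _
      _ = (n + 2) ^ 4 := by ring
  exact h1.trans (Nat.pow_le_pow_left (by omega) 4)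

/-- Degree arithmetic: `n(n+1) + 1 ≤ (B + n + 2)^3`. [folklore] -/
theorem arith_degree (B n : ℕ) : n * (n + 1) + 1 ≤ (B + n + 2) ^ 3 := by
  have h1 : n * (n + 1) + 1 ≤ (n + 2) ^ 3 :=
    calc n * (n + 1) + 1 ≤ n * (n + 1) + 1 + (n ^ 3 + 5 * n ^ 2 + 11 * n + 7) :=
          Nat.le_add_right _ _
      _ = (n + 2) ^ 3 := by ring
  exact h1.trans (Nat.pow_le_pow_left (by omega) 3)

/-! ### The generic gadget `Σ_e (∏_l Λ_{n, e l}(T l)) · X_{x e}` over block sums `T l` -/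

/-- Size of the gadget: `≤ (B+n+2)^4 · C(2n,n)` when every `L(T l) ≤ n` (`C(2n-1,n)` summands of
size `≤ n((n+1)(n+2) + (n+1)) + n + 1`; Bürgisser 2000, §2.1). [folklore] -/
theorem complexity_gadget_le [Fintype (topMonomials n)] (T : Fin n → MvPolynomial σ ℂ)
    (x : topMonomials n → σ) (B : ℕ) (hT : ∀ l, complexity (T l) ≤ n) :
    complexity (∑ e : topMonomials n,
      (∏ l : Fin n, ∏ w ∈ (Finset.range (n + 1)).erase ((e : Fin n →₀ ℕ) l),
        (C ((((e : Fin n →₀ ℕ) l : ℂ) - (w : ℂ))⁻¹) * (T l + C (-(w : ℂ))))) * X (x e)) ≤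
      (B + n + 2) ^ 4 * Nat.choose (2 * n) n := by
  have hF : ∀ e ∈ (Finset.univ : Finset (topMonomials n)),
      complexity ((∏ l : Fin n, ∏ w ∈ (Finset.range (n + 1)).erase ((e : Fin n →₀ ℕ) l),
        (C ((((e : Fin n →₀ ℕ) l : ℂ) - (w : ℂ))⁻¹) * (T l + C (-(w : ℂ))))) * X (x e)) ≤
        n * ((n + 1) * (n + 2) + (n + 1)) + n + 1 := by
    intro e _
    have h1 : complexity (∏ l : Fin n, ∏ w ∈ (Finset.range (n + 1)).erase ((e : Fin n →₀ ℕ) l),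
        (C ((((e : Fin n →₀ ℕ) l : ℂ) - (w : ℂ))⁻¹) * (T l + C (-(w : ℂ))))) ≤
          n * ((n + 1) * (n + 2) + (n + 1)) + n := by
      refine (complexity_prod_le_of_le _ _ _ fun l _ =>
        complexity_lagrange_le (T l) _ (hT l)).trans ?_
      simp
    have h2 := complexity_mul_le_holds
      (∏ l : Fin n, ∏ w ∈ (Finset.range (n + 1)).erase ((e : Fin n →₀ ℕ) l),
        (C ((((e : Fin n →₀ ℕ) l : ℂ) - (w : ℂ))⁻¹) * (T l + C (-(w : ℂ))))) (X (x e))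
    have h3 := complexity_X_holds (k := ℂ) (x e)
    omega
  refine (complexity_sum_le_of_le _ _ _ hF).trans ?_
  rw [Finset.card_univ]
  calc Fintype.card (topMonomials n) * (n * ((n + 1) * (n + 2) + (n + 1)) + n + 1) +
        Fintype.card (topMonomials n)
      = Fintype.card (topMonomials n) * (n * ((n + 1) * (n + 2) + (n + 1)) + n + 1 + 1) := by
        ring
    _ ≤ (2 * n).choose n * (B + n + 2) ^ 4 :=
        Nat.mul_le_mul (card_topMonomials_le n) (arith_size B n)
    _ = (B + n + 2) ^ 4 * (2 * n).choose n := Nat.mul_comm _ _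

/-- Degree of the gadget: `≤ (B+n+2)^3` when every `deg (T l) ≤ 1`. [folklore] -/
theorem totalDegree_gadget_le [Fintype (topMonomials n)] (T : Fin n → MvPolynomial σ ℂ)
    (x : topMonomials n → σ) (B : ℕ) (hT : ∀ l, (T l).totalDegree ≤ 1) :
    (∑ e : topMonomials n,
      (∏ l : Fin n, ∏ w ∈ (Finset.range (n + 1)).erase ((e : Fin n →₀ ℕ) l),
        (C ((((e : Fin n →₀ ℕ) l : ℂ) - (w : ℂ))⁻¹) * (T l + C (-(w : ℂ))))) *
          X (x e)).totalDegree ≤ (B + n + 2) ^ 3 := by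
  refine (totalDegree_sum_le_of_le _ _ _ fun e _ => ?_).trans (arith_degree B n)
  refine (totalDegree_mul _ _).trans (Nat.add_le_add ?_ (totalDegree_X _).le)
  refine (totalDegree_prod_le_of_le _ _ _ fun l _ =>
    totalDegree_lagrange_le (T l) _ (hT l)).trans ?_
  simp

/-- Value of the gadget: if an algebra map `φ` sends every block sum `T l` to the count
`(expOf v) l`, then `φ` of the gadget is `φ (X_{x (expTop v)})` (the sum over `e` collapses to
`e = expTop v` by the Lagrange indicators). [folklore] -/
theorem aeval_gadget [Fintype (topMonomials n)] (T : Fin n → MvPolynomial σ ℂ)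
    (x : topMonomials n → σ) {S : Type*} [CommRing S] [Algebra ℂ S]
    (φ : MvPolynomial σ ℂ →ₐ[ℂ] S) (v : Fin n → Fin n) (hT : ∀ l, φ (T l) = (expOf v l : S)) :
    φ (∑ e : topMonomials n,
      (∏ l : Fin n, ∏ w ∈ (Finset.range (n + 1)).erase ((e : Fin n →₀ ℕ) l),
        (C ((((e : Fin n →₀ ℕ) l : ℂ) - (w : ℂ))⁻¹) * (T l + C (-(w : ℂ))))) * X (x e)) =
      φ (X (x (expTop v))) := by
  rw [map_sum]
  have h : ∀ e ∈ (Finset.univ : Finset (topMonomials n)),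
      φ ((∏ l : Fin n, ∏ w ∈ (Finset.range (n + 1)).erase ((e : Fin n →₀ ℕ) l),
        (C ((((e : Fin n →₀ ℕ) l : ℂ) - (w : ℂ))⁻¹) * (T l + C (-(w : ℂ))))) * X (x e)) =
        if expTop v = e then φ (X (x e)) else 0 := by
    intro e _
    rw [map_mul, map_prod]
    have h1 : ∀ l ∈ (Finset.univ : Finset (Fin n)),
        φ (∏ w ∈ (Finset.range (n + 1)).erase ((e : Fin n →₀ ℕ) l),
          (C ((((e : Fin n →₀ ℕ) l : ℂ) - (w : ℂ))⁻¹) * (T l + C (-(w : ℂ))))) =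
          if expOf v l = (e : Fin n →₀ ℕ) l then 1 else 0 :=
      fun l _ => aeval_lagrange φ (T l) (expOf_apply_le v l) (hT l)
    have h2 : (∀ l ∈ (Finset.univ : Finset (Fin n)), expOf v l = (e : Fin n →₀ ℕ) l) ↔
        expTop v = e := by
      constructor
      · intro hl
        exact Subtype.ext (Finsupp.ext fun l => hl l (Finset.mem_univ l))
      · rintro rfl l _
        rfl
    rw [Finset.prod_congr rfl h1, Finset.prod_boole, boole_mul]
    exact @if_congr _ _ _ (_) (_) _ _ _ _ h2 rfl rfl
  rw [Finset.sum_congr rfl h, Finset.sum_ite_eq, if_pos (Finset.mem_univ _)]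

/-! ### The block sums `T_{k,l} = Σ_pos Z_{(k,pos),l}` of the one-hot block -/

variable {D : ℕ}

/-- `L(T_{k,l}) ≤ n` (a sum of `n` variables). [folklore] -/
theorem complexity_blockSum_le (k : Fin D) (l : Fin n) :
    complexity (∑ pos : Fin n, (X (Sum.inr ((k, pos), l)) :
      MvPolynomial (topMonomials n ⊕ BPos D n) ℂ)) ≤ n := by
  refine (complexity_sum_le_of_le _ _ 0 fun _ _ => (complexity_X_holds _).le).trans ?_
  simp

/-- `deg T_{k,l} ≤ 1`. [folklore] -/
theorem totalDegree_blockSum_le (k : Fin D) (l : Fin n) :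
    (∑ pos : Fin n, (X (Sum.inr ((k, pos), l)) :
      MvPolynomial (topMonomials n ⊕ BPos D n) ℂ)).totalDegree ≤ 1 :=
  totalDegree_sum_le_of_le _ _ 1 fun _ _ => (totalDegree_X _).le

/-- At the one-hot point of `i`, the block sum `T_{k,l}` is the count `(expOf (i (k,·))) l`.
[folklore] -/
theorem aeval_blockSum (i : Fin D × Fin n → Fin n) (k : Fin D) (l : Fin n) :
    aeval (boolPt (oneHot i)) (∑ pos : Fin n, (X (Sum.inr ((k, pos), l)) :
      MvPolynomial (topMonomials n ⊕ BPos D n) ℂ)) =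
      ((expOf (fun pos => i (k, pos)) l : ℕ) : MvPolynomial (topMonomials n) ℂ) := by
  rw [map_sum, expOf_apply]
  simp [boolPt, oneHot, Finset.sum_boole]

/-- The selector gadget of block `k` (block sums `T_{k,l}`, coefficient variables `Sum.inl`):
size `≤ (B+n+2)^4 · C(2n,n)`, degree `≤ (B+n+2)^3`, value `X_{expTop (i (k,·))}` at the one-hot
point of every `i` (for any `Fintype` structure on `topMonomials n`). [folklore] -/
theorem block_spec [Fintype (topMonomials n)] (B : ℕ) (k : Fin D) :
    complexity (∑ e : topMonomials n,
      (∏ l : Fin n, ∏ w ∈ (Finset.range (n + 1)).erase ((e : Fin n →₀ ℕ) l),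
        (C ((((e : Fin n →₀ ℕ) l : ℂ) - (w : ℂ))⁻¹) *
          ((∑ pos : Fin n, (X (Sum.inr ((k, pos), l)) :
            MvPolynomial (topMonomials n ⊕ BPos D n) ℂ)) + C (-(w : ℂ))))) * X (Sum.inl e)) ≤
        (B + n + 2) ^ 4 * Nat.choose (2 * n) n ∧
      (∑ e : topMonomials n,
        (∏ l : Fin n, ∏ w ∈ (Finset.range (n + 1)).erase ((e : Fin n →₀ ℕ) l),
          (C ((((e : Fin n →₀ ℕ) l : ℂ) - (w : ℂ))⁻¹) *
            ((∑ pos : Fin n, (X (Sum.inr ((k, pos), l)) :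
              MvPolynomial (topMonomials n ⊕ BPos D n) ℂ)) + C (-(w : ℂ))))) *
                X (Sum.inl e)).totalDegree ≤ (B + n + 2) ^ 3 ∧
      ∀ i : Fin D × Fin n → Fin n, aeval (boolPt (oneHot i)) (∑ e : topMonomials n,
        (∏ l : Fin n, ∏ w ∈ (Finset.range (n + 1)).erase ((e : Fin n →₀ ℕ) l),
          (C ((((e : Fin n →₀ ℕ) l : ℂ) - (w : ℂ))⁻¹) *
            ((∑ pos : Fin n, (X (Sum.inr ((k, pos), l)) :
              MvPolynomial (topMonomials n ⊕ BPos D n) ℂ)) + C (-(w : ℂ))))) * X (Sum.inl e)) =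
        X (expTop fun l => i (k, l)) := by
  refine ⟨complexity_gadget_le (fun l => ∑ pos : Fin n, X (Sum.inr ((k, pos), l))) Sum.inl B
      fun l => complexity_blockSum_le k l,
    totalDegree_gadget_le (fun l => ∑ pos : Fin n, X (Sum.inr ((k, pos), l))) Sum.inl B
      fun l => totalDegree_blockSum_le k l, fun i => ?_⟩
  rw [aeval_gadget (fun l => ∑ pos : Fin n, X (Sum.inr ((k, pos), l))) Sum.inl
    (aeval (boolPt (oneHot i))) (fun pos => i (k, pos)) fun l => aeval_blockSum i k l, aeval_X]
  rfl

end SelGadget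

/-- **Selector gadget** (registered stub `stub_selGadget`, V3 of the line): for every `B`-bounded
datum `τ` on `n ≥ 1` tensor positions per block, `selSpec n τ B` holds — witnessed by the
Lagrange count-indicator gadgets `Σ_e (∏_l Λ_{n, e l}(T_{k,l})) · X_e` (`SelGadget.block_spec`;
neither `1 ≤ n` nor the bound `τ.Bounded B` is needed). [folklore] -/
theorem stub_selGadget :
    ∀ (n : ℕ) (τ : TabDatum n) (B : ℕ), 1 ≤ n → τ.Bounded B → selSpec n τ B := by
  intro n τ B _ _
  letI : Fintype (topMonomials n) :=
    Fintype.ofFinset ((Finset.univ : Finset (Fin n)).finsuppAntidiag n)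
      fun e => (degree_eq_iff_mem_finsuppAntidiag e n).symm
  unfold selSpec
  exact ⟨_, fun k => SelGadget.block_spec B k⟩

end Summit.ValiantsHypothesis.ValiantsHypothesis.Theorems.BarrierLeverDefinableEquations

end
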